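import Mathlib.Combinatorics.SetFamily.HarrisKleitman
import Mathlib.Data.Finset.Sups
import Mathlib.Tactic.Linarith
import Mathlib.Tactic.Ring
import Mathlib.Tactic.Positivity

/-!
# `NoHeavyLowerTail` (crux stmt-CriticalPhenomena-4575), lane prim-ineq-gen-4 (gen 29): the "band-Harris ⇒ anti-band" bridge

Support file (`--supports stmt-CriticalPhenomena-4575`; memo `run/shared/lean/prim/prim-ineq-gen-4/FINDING-LEVEL-HARRIS-g29.md` §0(3), §2).
Pure finite combinatorics, no definitions, no `sorry`, standard axioms.

CONTEXT.  The anti-band inequality (AB_l)(n) of the lane (memo FINDING-SHIFTING-AB-g20): for up-sets `A, B` of `Finset (Fin n)`, `2l ≤ n`,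
`#{s ∈ A ∩ Bᶜˢ | #s < l ∨ #sᶜ < l} ≤ #{s ∈ A ∩ B | #s < l ∨ #sᶜ < l}`.  Gen 29 found (and verified exhaustively for `n ≤ 7`, by an exhaustive
`n = 8` computation and randomised search up to `n = 14`) a Harris-type inequality with the middle band COLLAPSED to one point which implies it:

  (IB)  for all up-sets `A, B` and the band `S = {s | l ≤ #s ∧ l ≤ #sᶜ}`:
        `#A · #B · #S ≤ 2^n · #S · #{s ∈ A ∩ B | #s < l ∨ #sᶜ < l} + 2^n · #{s ∈ A | s ∈ S} · #{s ∈ B | s ∈ S}`,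

i.e. `Cov(1_A, 1_B) ≥ μ(S) · Cov(1_A, 1_B | S)` for the uniform measure ("Harris survives discarding the covariance inside the middle band").
This file proves the implication **(IB) at `(n, l)` ⇒ (AB_l)(n)** for all `n, l` with `2l ≤ n` (`antiBand_of_bandHarris`): apply (IB) to `(A, B)` and to
`(A, (Bᶜˢ)ᶜ)` and add — the band is closed under complementation, so the two band terms sum to `2^n · #{s ∈ A | s ∈ S} · #S` and the two
left-hand sides to `2^n · #A · #S`; dividing by `2^n · #S` leaves exactly (AB_l)(n).  At the diagonal `n = 2l` the band is the single middle level and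
(IB) reads `Cov(f,g) ≥ P(#x = l) · Cov(f, g | #x = l)` for increasing `f, g`.
-/

namespace Summit.CriticalPhenomena.PercolationContinuityZ3.Theorems.AntiBandLevelHarrisBridge

open Finset
open scoped FinsetFamily

/-- **Band-Harris implies the anti-band inequality.**  Let `2l ≤ n` and suppose that for all up-sets `A, B` of `Finset (Fin n)`, with
`S = {s | l ≤ #s ∧ l ≤ #sᶜ}` the middle band,
`#A · #B · #S ≤ 2^n · #S · #{s ∈ A ∩ B | #s < l ∨ #sᶜ < l} + 2^n · #{s ∈ A | l ≤ #s ∧ l ≤ #sᶜ} · #{s ∈ B | l ≤ #s ∧ l ≤ #sᶜ}`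
(the Harris inequality for the uniform measure with the band collapsed to one point).  Then (AB_l)(n) holds for all pairs of up-sets:
`#{s ∈ A ∩ Bᶜˢ | #s < l ∨ #sᶜ < l} ≤ #{s ∈ A ∩ B | #s < l ∨ #sᶜ < l}`. [gen 29, FINDING-LEVEL-HARRIS-g29 §2] -/
theorem antiBand_of_bandHarris {n : ℕ} (l : ℕ) (h2l : 2 * l ≤ n)
    (hIB : ∀ A B : Finset (Finset (Fin n)), IsUpperSet (A : Set (Finset (Fin n))) →
      IsUpperSet (B : Set (Finset (Fin n))) →
      #A * #B * #((univ : Finset (Finset (Fin n))).filter fun s => l ≤ #s ∧ l ≤ #sᶜ)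
        ≤ 2 ^ n * #((univ : Finset (Finset (Fin n))).filter fun s => l ≤ #s ∧ l ≤ #sᶜ)
              * #((A ∩ B).filter fun s => #s < l ∨ #sᶜ < l)
          + 2 ^ n * #(A.filter fun s => l ≤ #s ∧ l ≤ #sᶜ) * #(B.filter fun s => l ≤ #s ∧ l ≤ #sᶜ))
    (A B : Finset (Finset (Fin n))) (hA : IsUpperSet (A : Set (Finset (Fin n))))
    (hB : IsUpperSet (B : Set (Finset (Fin n)))) :
    #((A ∩ Bᶜˢ).filter fun s => #s < l ∨ #sᶜ < l) ≤ #((A ∩ B).filter fun s => #s < l ∨ #sᶜ < l) := by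
  classical
  -- `B' = (Bᶜˢ)ᶜ` is an up-set
  have hB'up : IsUpperSet (((Bᶜˢ)ᶜ : Finset (Finset (Fin n))) : Set (Finset (Fin n))) := by
    intro s t hst hs
    rw [Finset.mem_coe, Finset.mem_compl, Finset.mem_compls] at hs ⊢
    intro ht
    exact hs (hB (compl_le_compl hst) ht)
  have h1 := hIB A B hA hB
  have h2 := hIB A (Bᶜˢ)ᶜ hA hB'up
  -- the band predicate is complement invariant; the outer predicate is its negation
  have hband_compl : ∀ s : Finset (Fin n), (l ≤ #sᶜ ∧ l ≤ #sᶜᶜ) ↔ (l ≤ #s ∧ l ≤ #sᶜ) := by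
    intro s; rw [compl_compl]; exact And.comm
  have houter_iff : ∀ s : Finset (Fin n), (#s < l ∨ #sᶜ < l) ↔ ¬ (l ≤ #s ∧ l ≤ #sᶜ) := by
    intro s; omega
  -- (1) #B' + #B = 2^n
  have hcardB' : #((Bᶜˢ)ᶜ : Finset (Finset (Fin n))) + #B = 2 ^ n := by
    rw [Finset.card_compl, Finset.card_compls, Fintype.card_finset, Fintype.card_fin]
    have : #B ≤ 2 ^ n := by
      calc #B ≤ #(univ : Finset (Finset (Fin n))) := card_le_card (subset_univ _)
        _ = 2 ^ n := by rw [card_univ, Fintype.card_finset, Fintype.card_fin]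
    omega
  -- (2) band part of B' plus band part of B = the whole band
  have hBcs_band : #(Bᶜˢ.filter fun s => l ≤ #s ∧ l ≤ #sᶜ) = #(B.filter fun s => l ≤ #s ∧ l ≤ #sᶜ) := by
    have : (B.filter fun s => l ≤ #s ∧ l ≤ #sᶜ)ᶜˢ = Bᶜˢ.filter fun s => l ≤ #s ∧ l ≤ #sᶜ := by
      ext a
      rw [mem_compls, mem_filter, mem_filter, mem_compls, hband_compl]
    rw [← this, card_compls]
  have hB'band : #(((Bᶜˢ)ᶜ : Finset (Finset (Fin n))).filter fun s => l ≤ #s ∧ l ≤ #sᶜ)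
      + #(B.filter fun s => l ≤ #s ∧ l ≤ #sᶜ)
      = #((univ : Finset (Finset (Fin n))).filter fun s => l ≤ #s ∧ l ≤ #sᶜ) := by
    rw [← hBcs_band]
    have hdisj : Disjoint (((Bᶜˢ)ᶜ : Finset (Finset (Fin n))).filter fun s => l ≤ #s ∧ l ≤ #sᶜ)
        (Bᶜˢ.filter fun s => l ≤ #s ∧ l ≤ #sᶜ) := by
      rw [Finset.disjoint_left]
      intro a ha ha'
      rw [mem_filter, Finset.mem_compl] at ha
      exact ha.1 (mem_filter.mp ha').1
    rw [← card_union_of_disjoint hdisj]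
    congr 1
    ext a
    rw [mem_union, mem_filter, mem_filter, mem_filter, Finset.mem_compl]
    constructor
    · rintro (⟨_, h⟩ | ⟨_, h⟩) <;> exact ⟨mem_univ _, h⟩
    · rintro ⟨_, h⟩
      by_cases hm : a ∈ Bᶜˢ
      · exact Or.inr ⟨hm, h⟩
      · exact Or.inl ⟨hm, h⟩
  -- (3) outer part of A ∩ B' plus outer part of A ∩ Bᶜˢ = outer part of A
  have hAB'outer : #((A ∩ (Bᶜˢ)ᶜ).filter fun s => #s < l ∨ #sᶜ < l)
      + #((A ∩ Bᶜˢ).filter fun s => #s < l ∨ #sᶜ < l)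
      = #(A.filter fun s => #s < l ∨ #sᶜ < l) := by
    have hdisj : Disjoint ((A ∩ (Bᶜˢ)ᶜ).filter fun s => #s < l ∨ #sᶜ < l)
        ((A ∩ Bᶜˢ).filter fun s => #s < l ∨ #sᶜ < l) := by
      rw [Finset.disjoint_left]
      intro a ha ha'
      rw [mem_filter, mem_inter, Finset.mem_compl] at ha
      exact ha.1.2 (mem_inter.mp (mem_filter.mp ha').1).2
    rw [← card_union_of_disjoint hdisj]
    congr 1
    ext a
    rw [mem_union, mem_filter, mem_filter, mem_filter, mem_inter, mem_inter, Finset.mem_compl]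
    constructor
    · rintro (⟨⟨h, _⟩, ho⟩ | ⟨⟨h, _⟩, ho⟩) <;> exact ⟨h, ho⟩
    · rintro ⟨h, ho⟩
      by_cases hm : a ∈ Bᶜˢ
      · exact Or.inr ⟨⟨h, hm⟩, ho⟩
      · exact Or.inl ⟨⟨h, hm⟩, ho⟩
  -- (4) #A = outer part + band part
  have hAsplit : #(A.filter fun s => #s < l ∨ #sᶜ < l) + #(A.filter fun s => l ≤ #s ∧ l ≤ #sᶜ) = #A := by
    rw [← card_filter_add_card_filter_not (s := A) (fun s : Finset (Fin n) => #s < l ∨ #sᶜ < l)]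
    congr 2
    ext a
    rw [mem_filter, mem_filter, houter_iff, not_not]
  -- (5) the band is non-empty (any `l`-subset lies in it since `2l ≤ n`)
  have hSpos : 0 < #((univ : Finset (Finset (Fin n))).filter fun s => l ≤ #s ∧ l ≤ #sᶜ) := by
    obtain ⟨s, hs⟩ := (Finset.powersetCard_nonempty (s := (univ : Finset (Fin n))) (n := l)).mpr
      (by rw [card_univ, Fintype.card_fin]; omega)
    rw [mem_powersetCard] at hs
    rw [card_pos]
    refine ⟨s, ?_⟩
    rw [mem_filter, Finset.card_compl, Fintype.card_fin]
    exact ⟨mem_univ _, by omega, by omega⟩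
  -- (6) add the two instances of (IB) and divide by `2^n · #S`
  have key : 2 ^ n * #((univ : Finset (Finset (Fin n))).filter fun s => l ≤ #s ∧ l ≤ #sᶜ) * #A
      ≤ 2 ^ n * #((univ : Finset (Finset (Fin n))).filter fun s => l ≤ #s ∧ l ≤ #sᶜ)
          * (#((A ∩ B).filter fun s => #s < l ∨ #sᶜ < l)
              + #((A ∩ (Bᶜˢ)ᶜ).filter fun s => #s < l ∨ #sᶜ < l)
              + #(A.filter fun s => l ≤ #s ∧ l ≤ #sᶜ)) := by
    have e1 : 2 ^ n * #((univ : Finset (Finset (Fin n))).filter fun s => l ≤ #s ∧ l ≤ #sᶜ) * #A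
        = #A * #B * #((univ : Finset (Finset (Fin n))).filter fun s => l ≤ #s ∧ l ≤ #sᶜ)
          + #A * #((Bᶜˢ)ᶜ : Finset (Finset (Fin n))) * #((univ : Finset (Finset (Fin n))).filter fun s => l ≤ #s ∧ l ≤ #sᶜ) := by
      rw [← hcardB']; ring
    have e2 : 2 ^ n * #((univ : Finset (Finset (Fin n))).filter fun s => l ≤ #s ∧ l ≤ #sᶜ)
          * (#((A ∩ B).filter fun s => #s < l ∨ #sᶜ < l)
              + #((A ∩ (Bᶜˢ)ᶜ).filter fun s => #s < l ∨ #sᶜ < l)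
              + #(A.filter fun s => l ≤ #s ∧ l ≤ #sᶜ))
        = (2 ^ n * #((univ : Finset (Finset (Fin n))).filter fun s => l ≤ #s ∧ l ≤ #sᶜ)
              * #((A ∩ B).filter fun s => #s < l ∨ #sᶜ < l)
            + 2 ^ n * #(A.filter fun s => l ≤ #s ∧ l ≤ #sᶜ) * #(B.filter fun s => l ≤ #s ∧ l ≤ #sᶜ))
          + (2 ^ n * #((univ : Finset (Finset (Fin n))).filter fun s => l ≤ #s ∧ l ≤ #sᶜ)
              * #((A ∩ (Bᶜˢ)ᶜ).filter fun s => #s < l ∨ #sᶜ < l)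
            + 2 ^ n * #(A.filter fun s => l ≤ #s ∧ l ≤ #sᶜ)
              * #(((Bᶜˢ)ᶜ : Finset (Finset (Fin n))).filter fun s => l ≤ #s ∧ l ≤ #sᶜ)) := by
      rw [← hB'band]; ring
    rw [e1, e2]
    exact add_le_add h1 h2
  have key2 : #A ≤ #((A ∩ B).filter fun s => #s < l ∨ #sᶜ < l)
      + #((A ∩ (Bᶜˢ)ᶜ).filter fun s => #s < l ∨ #sᶜ < l) + #(A.filter fun s => l ≤ #s ∧ l ≤ #sᶜ) :=
    Nat.le_of_mul_le_mul_left key (by positivity)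
  omega

end Summit.CriticalPhenomena.PercolationContinuityZ3.Theorems.AntiBandLevelHarrisBridge
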